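import Summits.BirchSwinnertonDyer.BirchSwinnertonDyer.Theses.TwoAdicConverse
import Summits.BirchSwinnertonDyer.BirchSwinnertonDyer.Theses.ByReductionTypeAtTwo
import Summits.BirchSwinnertonDyer.BirchSwinnertonDyer.Theorems.TwoAdicConverseEulerCharKernelAtTwoHolds
import HarnessLib

/-!
# Item 19265 `GreenbergRankZeroFormulaAnyPrime` (routes S3 `TwoAdicConverse` and K4 `ByReductionTypeAtTwo`) — CLOSED by name

HONEST FRAMING (cell `pub/bsd-2adic`, seat conv-1): this file proves NO new mathematics. The support
item stmt-BirchSwinnertonDyer-19265 asks, BY NAME, for the named Literature fact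
`Literature.NumberTheory.EllipticCurves.Greenberg1999.thm41_charValue_rankZero_anyPrime`
(Greenberg, LNM 1716 (1999), Theorem 4.1: the rank-`0` Euler-characteristic / characteristic-value
formula for `Sel_{p^∞}(E/ℚ_∞)` at EVERY good ordinary prime `p`, `p = 2` included, parity-free
statement). That fact is a KERNEL THEOREM of the tree since 2026-08-30:
`Summit.BirchSwinnertonDyer.BirchSwinnertonDyer.Theorems.TwoAdicEulerCharKernel.thm41_charValue_rankZero_anyPrime_holds`
(conv-1 GEN 37, `Theorems/TwoAdicConverseEulerCharKernelAtTwoHolds.lean`), assembled from tower-1's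
two legs — odd `p`: `TorsionEulerChar.H46.greenberg_charValue_rankZero_holds`
(`Theorems/ByReductionTypeAtTwoTorsionEulerCharH46OddPrimes.lean`); `p = 2`, every curve:
`TorsionEulerChar.H46.twoAdicEulerCharRankZero` (`Theorems/ByReductionTypeAtTwoTorsionEulerCharH46.lean`)
— through Greenberg's Lemma 4.6 argument run in the kernel (no printed fact is read).

Both route files carry the item as a `def … : Prop := <that constant>`; the two theorems below state
the FULLY-QUALIFIED route decls and are closed by the `_holds` theorem (the `def`s unfold
definitionally). Closes rung-leaf item 19265 of BirchSwinnertonDyer on both routes; books nothing;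
BSD is not proved by any of this.
-/

set_option linter.dupNamespace false -- `…BirchSwinnertonDyer.BirchSwinnertonDyer…` is the cell's nested layout (D-0017)
set_option autoImplicit false

namespace Summit.BirchSwinnertonDyer.BirchSwinnertonDyer.Theorems

/-- **Item stmt-BirchSwinnertonDyer-19265 on route S3 `TwoAdicConverse`**: the route decl
`Theses.TwoAdicConverse.GreenbergRankZeroFormulaAnyPrime`
(`:= Greenberg1999.thm41_charValue_rankZero_anyPrime`, Greenberg LNM 1716 Thm. 4.1 at every good
ordinary prime, rank `0`) HOLDS — by the kernel theorem
`TwoAdicEulerCharKernel.thm41_charValue_rankZero_anyPrime_holds`. [cite: GreenbergLNM1716, Thm. 4.1] -/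
theorem twoAdicConverse_greenbergRankZeroFormulaAnyPrime_proof :
    Summit.BirchSwinnertonDyer.BirchSwinnertonDyer.Theses.TwoAdicConverse.GreenbergRankZeroFormulaAnyPrime :=
  TwoAdicEulerCharKernel.thm41_charValue_rankZero_anyPrime_holds

/-- **Item stmt-BirchSwinnertonDyer-19265 on route K4 `ByReductionTypeAtTwo`**: the twin route decl
`Theses.ByReductionTypeAtTwo.GreenbergRankZeroFormulaAnyPrime` (same body
`Greenberg1999.thm41_charValue_rankZero_anyPrime`) HOLDS — same kernel theorem.
[cite: GreenbergLNM1716, Thm. 4.1] -/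
theorem byReductionTypeAtTwo_greenbergRankZeroFormulaAnyPrime_proof :
    Summit.BirchSwinnertonDyer.BirchSwinnertonDyer.Theses.ByReductionTypeAtTwo.GreenbergRankZeroFormulaAnyPrime :=
  TwoAdicEulerCharKernel.thm41_charValue_rankZero_anyPrime_holds

end Summit.BirchSwinnertonDyer.BirchSwinnertonDyer.Theorems
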